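import Mathlib
import Literature.Analysis.FluidPDE.SuitableWeak
import Literature.Analysis.FluidPDE.WeakGradientSlicing
import Literature.Analysis.FunctionSpaces.DistributionalConstancy
import Summits.NavierStokesRegularity.NavierStokesRegularity.Theorems.EulerZoomLiouvillePowerGaugeEulerLiouvilleWeakTimeTestedField
import Summits.NavierStokesRegularity.NavierStokesRegularity.Theorems.EulerZoomLiouvillePowerGaugeEulerLiouvillePastFrameSteadyConfined
import HarnessLib

/-!
# Crux `EulerZoomLiouville.PowerGaugeEulerLiouville` (stmt-NavierStokesRegularity-19832), stub `stub_nonSelfSimilarRest`: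
# DISTRIBUTIONALLY STEADY ⇒ A.E. STEADY on a past slab (the parametric du Bois-Reymond lemma, sliced in time)

Helper file (theorems only; `--supports stmt-NavierStokesRegularity-19832`; def-free; pure analysis).  Hand leafhand-ns-eulerzoomliouville-10 g3;
the bridge between `…WeakAntiEquivariantMember` (wrong-parity members are steady in `𝒟'`: `∫∫ θ'(t)⟪u(t,x), Φ(x)⟫ = 0`) and `…AePastSteady`
(a.e.-steady members are trivial).

`DistSteady.exists_ae_eq_slice`: if `u` is locally integrable on the slab `(−∞,T) × ℝ³` with locally integrable a.e. slice, and
`∫∫ θ'(t) ⟪u(t,x), Φ(x)⟫ dt dx = 0` for all `θ ∈ C_c^∞((−∞,T))` and all continuous compactly supported fields `Φ`, then there is `U` (an a.e.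
slice `u(t₀)`) with `u(t, x) = U(x)` for a.e. `(t, x)` in the slab.  Proof: for a scalar test function `χ` and a vector `e` the pairing
`g(t) = ∫ χ(x)⟪u(t,x), e⟫ dx` is integrable on compact windows (Fubini) and `∫ θ' g = 0` (Fubini), so it is a.e. constant on every window
(`ae_eq_const_of_forall_setIntegral_deriv_mul_eq_zero` [Brezis2011 Lemma 8.1]); countably many `χ` (the tree's `C¹`-dense families
`exists_countable_testFunctions_dense`) and the three basis vectors give a full-measure set of good times at which ALL pairings agree with those at a
fixed good time `t₀` (density + dominated convergence `tendsto_integral_mul_of_tendstoUniformly`), whence `u(t) = u(t₀)` a.e. by the fundamental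
lemma of the calculus of variations (`ae_eq_zero_of_integral_contDiff_smul_eq_zero`); slices to slab by `FrameSteady.ae_zero_of_ae_slice`.

WHAT THIS IS NOT: nothing about Euler or Navier–Stokes by itself; not a proof of any stub. [folklore; Brezis2011 Lemma 8.1]
-/

noncomputable section

-- flat `Theorems/<Route><Decl>…` files of one crux share the namespace of the crux (tree convention)
set_option linter.dupNamespace false

open MeasureTheory Set Filter Topology Metric Function TopologicalSpace
open scoped RealInnerProductSpace NNReal ENNReal ContDiff

namespace Summit.NavierStokesRegularity.NavierStokesRegularity.Theorems.PowerGaugeEulerLiouville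

open Literature.Analysis Literature.Analysis.FunctionSpaces Literature.Analysis.FluidPDE

namespace DistSteady

variable {u : ℝ → EuclideanSpace ℝ (Fin 3) → EuclideanSpace ℝ (Fin 3)} {T : ℝ}

/-! ## 1. The pairings `g(t) = ∫ χ(x) ⟪u(t,x), e⟫ dx` on a compact time window -/

/-- `χ(x) ⟪u(t,x), e⟫` is integrable on `(a,b) × ℝ³` for `b < T`. [folklore] -/
theorem integrable_pairing_prod
    (hu : LocallyIntegrableOn (uncurry u) (Iio T ×ˢ (univ : Set (EuclideanSpace ℝ (Fin 3)))) volume)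
    {a b : ℝ} (hbT : b < T) {χ : EuclideanSpace ℝ (Fin 3) → ℝ} (hχ : Continuous χ) (hχc : HasCompactSupport χ)
    (e : EuclideanSpace ℝ (Fin 3)) :
    Integrable (fun z : ℝ × EuclideanSpace ℝ (Fin 3) => χ z.2 * ⟪u z.1 z.2, e⟫)
      (((volume : Measure ℝ).restrict (Ioo a b)).prod (volume : Measure (EuclideanSpace ℝ (Fin 3)))) := by
  -- adapted from Literature/Analysis/FluidPDE/WeakGradientSlicing.lean (`integrable_fderiv_mul_inner_prod`)
  have hC : IsCompact (Icc a b ×ˢ tsupport χ) := isCompact_Icc.prod hχc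
  have hCQ : Icc a b ×ˢ tsupport χ ⊆ Iio T ×ˢ (univ : Set (EuclideanSpace ℝ (Fin 3))) :=
    prod_mono (fun t ht => lt_of_le_of_lt ht.2 hbT) (subset_univ _)
  have huC : IntegrableOn (uncurry u) (Icc a b ×ˢ tsupport χ) volume := hu.integrableOn_compact_subset hCQ hC
  have hθ : Continuous fun z : ℝ × EuclideanSpace ℝ (Fin 3) => χ z.2 := hχ.comp continuous_snd
  have h1 : IntegrableOn (fun z : ℝ × EuclideanSpace ℝ (Fin 3) => χ z.2 * ⟪u z.1 z.2, e⟫) (Icc a b ×ˢ tsupport χ) volume :=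
    IntegrableOn.continuousOn_mul hθ.continuousOn (huC.inner_const e) hC
  have h2 : IntegrableOn (fun z : ℝ × EuclideanSpace ℝ (Fin 3) => χ z.2 * ⟪u z.1 z.2, e⟫)
      (Ioo a b ×ˢ (univ : Set (EuclideanSpace ℝ (Fin 3)))) volume := by
    refine (h1.of_forall_sdiff_eq_zero (measurableSet_Icc.prod MeasurableSet.univ) ?_).mono_set
      (prod_mono Ioo_subset_Icc_self Subset.rfl)
    rintro ⟨t, x⟩ ⟨htx, hz⟩
    have hx : x ∉ tsupport χ := fun hx => hz ⟨(mem_prod.1 htx).1, hx⟩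
    simp [image_eq_zero_of_notMem_tsupport hx]
  rw [Measure.restrict_prod_eq_prod_univ (Ioo a b), ← Measure.volume_eq_prod]
  exact h2

/-- The pairing `g(t) = ∫ χ ⟪u(t), e⟫` is integrable on every window `(a,b)`, `b < T`. [folklore] -/
theorem integrableOn_pairing
    (hu : LocallyIntegrableOn (uncurry u) (Iio T ×ˢ (univ : Set (EuclideanSpace ℝ (Fin 3)))) volume)
    {a b : ℝ} (hbT : b < T) {χ : EuclideanSpace ℝ (Fin 3) → ℝ} (hχ : Continuous χ) (hχc : HasCompactSupport χ)
    (e : EuclideanSpace ℝ (Fin 3)) :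
    IntegrableOn (fun t => ∫ x, χ x * ⟪u t x, e⟫) (Ioo a b) volume :=
  (integrable_pairing_prod hu hbT hχ hχc e).integral_prod_left

/-- **The pairing has zero distributional time derivative** on the window: `∫ θ' g = 0` for `θ ∈ C_c^∞((a,b))`, `b < T`, whenever
`∫∫ θ'(t)⟪u(t,x), Φ(x)⟫ = 0` for the field `Φ = χ e`. [folklore] -/
theorem setIntegral_deriv_mul_pairing_eq_zero
    (hu : LocallyIntegrableOn (uncurry u) (Iio T ×ˢ (univ : Set (EuclideanSpace ℝ (Fin 3)))) volume)
    {a b : ℝ} (hbT : b ≤ T) {χ : EuclideanSpace ℝ (Fin 3) → ℝ} (hχ : Continuous χ) (hχc : HasCompactSupport χ)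
    (e : EuclideanSpace ℝ (Fin 3)) {θ : ℝ → ℝ} (hθ : ContDiff ℝ ∞ θ) (hθc : HasCompactSupport θ) (hθab : tsupport θ ⊆ Ioo a b)
    (hsteady : ∫ z : ℝ × EuclideanSpace ℝ (Fin 3), deriv θ z.1 * ⟪u z.1 z.2, χ z.2 • e⟫ = 0) :
    ∫ t in Ioo a b, deriv θ t * ∫ x, χ x * ⟪u t x, e⟫ = 0 := by
  have hθT : tsupport θ ⊆ Iio T := hθab.trans fun t ht => lt_of_lt_of_le ht.2 hbT
  obtain ⟨hκ, hκc, hκT⟩ := AntiMember.deriv_cutoff_props hθ hθc hθT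
  have hΦ : Continuous fun x => χ x • e := hχ.smul continuous_const
  have hΦc : HasCompactSupport fun x => χ x • e := hχc.smul_right (f' := fun _ : EuclideanSpace ℝ (Fin 3) => e)
  have hF := AntiMember.integrable_mul_inner_field hu hκ hκc hκT hΦ hΦc
  -- the window integral is the integral over `ℝ`
  have hvan : ∀ t : ℝ, t ∉ Ioo a b → deriv θ t * ∫ x, χ x * ⟪u t x, e⟫ = 0 := by
    intro t ht
    have h : t ∉ tsupport (deriv θ) := fun h => ht (hθab (tsupport_deriv_subset h))
    rw [image_eq_zero_of_notMem_tsupport h, zero_mul]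
  rw [setIntegral_eq_integral_of_forall_compl_eq_zero hvan]
  -- Fubini
  have e1 : ∫ t, deriv θ t * ∫ x, χ x * ⟪u t x, e⟫ = ∫ t, ∫ x, deriv θ t * ⟪u t x, χ x • e⟫ := by
    refine integral_congr_ae (Eventually.of_forall fun t => ?_)
    simp only
    rw [← integral_const_mul]
    refine integral_congr_ae (Eventually.of_forall fun x => ?_)
    show deriv θ t * (χ x * ⟪u t x, e⟫) = deriv θ t * ⟪u t x, χ x • e⟫
    rw [real_inner_smul_right]
  rw [e1]
  rw [Measure.volume_eq_prod] at hF
  have e2 := integral_prod _ hF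
  rw [← Measure.volume_eq_prod] at e2
  rw [← e2]
  exact hsteady

/-- **On each window the pairing is a.e. constant.** [folklore; Brezis2011 Lemma 8.1] -/
theorem exists_pairing_ae_const
    (hu : LocallyIntegrableOn (uncurry u) (Iio T ×ˢ (univ : Set (EuclideanSpace ℝ (Fin 3)))) volume)
    (hsteady : ∀ θ : ℝ → ℝ, ContDiff ℝ ∞ θ → HasCompactSupport θ → tsupport θ ⊆ Iio T →
      ∀ Φ : EuclideanSpace ℝ (Fin 3) → EuclideanSpace ℝ (Fin 3), Continuous Φ → HasCompactSupport Φ →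
        ∫ z : ℝ × EuclideanSpace ℝ (Fin 3), deriv θ z.1 * ⟪u z.1 z.2, Φ z.2⟫ = 0)
    {a b : ℝ} (hbT : b < T) {χ : EuclideanSpace ℝ (Fin 3) → ℝ} (hχ : Continuous χ) (hχc : HasCompactSupport χ)
    (e : EuclideanSpace ℝ (Fin 3)) :
    ∃ C : ℝ, ∀ᵐ t ∂(volume.restrict (Ioo a b)), ∫ x, χ x * ⟪u t x, e⟫ = C := by
  refine ae_eq_const_of_forall_setIntegral_deriv_mul_eq_zero (integrableOn_pairing hu hbT hχ hχc e) ?_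
  intro θ hθ hθc hθab
  have hθT : tsupport θ ⊆ Iio T := hθab.trans fun t ht => ht.2.trans hbT
  exact setIntegral_deriv_mul_pairing_eq_zero hu hbT.le hχ hχc e hθ hθc hθab
    (hsteady θ hθ hθc hθT _ (hχ.smul continuous_const) (hχc.smul_right (f' := fun _ : EuclideanSpace ℝ (Fin 3) => e)))

/-! ## 2. Density: pairings against countably many test functions determine the slice -/

/-- If two locally integrable fields have the same pairings `∫ χ ⟪·, eᵢ⟫` against every `χ` of `C⁰`-dense countable families supported in the
balls `B̄(0,n)` and the three basis vectors, they agree a.e. [folklore] -/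
theorem ae_eq_of_pairings_eq {f f' : EuclideanSpace ℝ (Fin 3) → EuclideanSpace ℝ (Fin 3)}
    (hf : LocallyIntegrable f volume) (hf' : LocallyIntegrable f' volume)
    {D : ℕ → Set (EuclideanSpace ℝ (Fin 3) → ℝ)}
    (hD : ∀ n : ℕ, ∀ ψ ∈ D n, IsTestFunctionOn (⊤ : Opens (EuclideanSpace ℝ (Fin 3))) ψ ∧ tsupport ψ ⊆ closedBall (0 : EuclideanSpace ℝ (Fin 3)) n)
    (hDd : ∀ n : ℕ, ∀ ψ : EuclideanSpace ℝ (Fin 3) → ℝ, IsTestFunctionOn (⊤ : Opens (EuclideanSpace ℝ (Fin 3))) ψ →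
      tsupport ψ ⊆ closedBall (0 : EuclideanSpace ℝ (Fin 3)) n →
        ∃ s : ℕ → EuclideanSpace ℝ (Fin 3) → ℝ, (∀ k, s k ∈ D n) ∧ TendstoUniformly s ψ atTop ∧
          TendstoUniformly (fun k => fderiv ℝ (s k)) (fderiv ℝ ψ) atTop)
    (heq : ∀ n : ℕ, ∀ χ ∈ D n, ∀ i : Fin 3,
      ∫ x, χ x * ⟪f x, EuclideanSpace.single i (1 : ℝ)⟫ = ∫ x, χ x * ⟪f' x, EuclideanSpace.single i (1 : ℝ)⟫) :
    f =ᵐ[volume] f' := by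
  have hcoord : ∀ i : Fin 3, (fun x => ⟪f x - f' x, EuclideanSpace.single i (1 : ℝ)⟫) =ᵐ[volume] 0 := by
    intro i
    set e : EuclideanSpace ℝ (Fin 3) := EuclideanSpace.single i (1 : ℝ) with he
    have hFl : LocallyIntegrable (fun x => ⟪f x - f' x, e⟫) volume := by
      have e1 : (fun x => ⟪f x - f' x, e⟫) = fun x => (innerSL ℝ e) (f x - f' x) := by
        funext x; simp only [innerSL_apply_apply, real_inner_comm]
      rw [e1, ← locallyIntegrableOn_univ]
      exact (innerSL ℝ e).locallyIntegrableOn_comp (locallyIntegrableOn_univ.2 (hf.sub hf'))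
    refine ae_eq_zero_of_integral_contDiff_smul_eq_zero hFl fun χ hχ hχc => ?_
    -- `χ` is supported in some closed ball
    obtain ⟨n, hn⟩ : ∃ n : ℕ, tsupport χ ⊆ closedBall (0 : EuclideanSpace ℝ (Fin 3)) n := by
      obtain ⟨R, hR⟩ := (hχc.isCompact : IsCompact (tsupport χ)).isBounded.subset_closedBall (0 : EuclideanSpace ℝ (Fin 3))
      obtain ⟨n, hn⟩ := exists_nat_ge R
      exact ⟨n, hR.trans (closedBall_subset_closedBall hn)⟩
    have hχT : IsTestFunctionOn (⊤ : Opens (EuclideanSpace ℝ (Fin 3))) χ := ⟨hχ, hχc, by simp⟩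
    obtain ⟨s, hsD, hsu, -⟩ := hDd n χ hχT hn
    set K : Set (EuclideanSpace ℝ (Fin 3)) := closedBall (0 : EuclideanSpace ℝ (Fin 3)) n with hK
    have hKc : IsCompact K := isCompact_closedBall _ _
    have hFK : IntegrableOn (fun x => ⟪f x - f' x, e⟫) K volume := hFl.integrableOn_isCompact hKc
    have hsc : ∀ k, Continuous (s k) := fun k => (hD n (s k) (hsD k)).1.contDiff.continuous
    have hsK : ∀ k, ∀ x ∉ K, s k x = 0 := fun k x hx =>
      image_eq_zero_of_notMem_tsupport fun h => hx ((hD n (s k) (hsD k)).2 h)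
    have hlim := tendsto_integral_mul_of_tendstoUniformly hKc hFK hsc hχ.continuous hsK hsu
    -- each term of the sequence vanishes
    have hzero : ∀ k, ∫ x, s k x * ⟪f x - f' x, e⟫ = 0 := by
      intro k
      have hsk := hD n (s k) (hsD k)
      have i1 : Integrable (fun x => s k x * ⟪f x, e⟫) volume :=
        integrable_mul_of_eq_zero_off_compact hKc (hsc k) (hsK k) ((hf.integrableOn_isCompact hKc).inner_const e)
      have i2 : Integrable (fun x => s k x * ⟪f' x, e⟫) volume :=
        integrable_mul_of_eq_zero_off_compact hKc (hsc k) (hsK k) ((hf'.integrableOn_isCompact hKc).inner_const e)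
      have e2 : (fun x => s k x * ⟪f x - f' x, e⟫) = fun x => s k x * ⟪f x, e⟫ - s k x * ⟪f' x, e⟫ := by
        funext x; rw [inner_sub_left]; ring
      rw [e2, integral_sub i1 i2, heq n (s k) (hsD k) i, sub_self]
    have hlim0 : Tendsto (fun k => ∫ x, s k x * ⟪f x - f' x, e⟫) atTop (𝓝 0) :=
      tendsto_const_nhds.congr fun k => (hzero k).symm
    have := tendsto_nhds_unique hlim hlim0
    simpa only [smul_eq_mul] using this
  have hall := ae_all_iff.2 hcoord
  filter_upwards [hall] with x hx
  rw [← sub_eq_zero]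
  ext i
  have h1 := hx i
  simp only [Pi.zero_apply] at h1
  rw [EuclideanSpace.inner_single_right] at h1
  simpa using h1

/-! ## 3. Distributionally steady ⇒ a.e. steady -/

/-- **DISTRIBUTIONALLY STEADY ⇒ A.E. EQUAL TO ONE SLICE.**  Let `u` be locally integrable on the slab `(−∞,T) × ℝ³` with locally integrable slices
`u(t)` for a.e. `t < T`, and suppose `∫∫ θ'(t) ⟪u(t,x), Φ(x)⟫ = 0` for every `θ ∈ C_c^∞((−∞,T))` and every continuous compactly supported
field `Φ`.  Then `u(t, x) = u(t₀, x)` for a.e. `(t, x) ∈ (−∞,T) × ℝ³`, for some `t₀ < T`. [folklore; Brezis2011 Lemma 8.1] -/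
theorem exists_ae_eq_slice
    (hu : LocallyIntegrableOn (uncurry u) (Iio T ×ˢ (univ : Set (EuclideanSpace ℝ (Fin 3)))) volume)
    (hsl : ∀ᵐ t ∂(volume.restrict (Iio T)), LocallyIntegrable (u t) volume)
    (hsteady : ∀ θ : ℝ → ℝ, ContDiff ℝ ∞ θ → HasCompactSupport θ → tsupport θ ⊆ Iio T →
      ∀ Φ : EuclideanSpace ℝ (Fin 3) → EuclideanSpace ℝ (Fin 3), Continuous Φ → HasCompactSupport Φ →
        ∫ z : ℝ × EuclideanSpace ℝ (Fin 3), deriv θ z.1 * ⟪u z.1 z.2, Φ z.2⟫ = 0) :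
    ∃ t₀ : ℝ, t₀ < T ∧ LocallyIntegrable (u t₀) volume ∧
      ∀ᵐ z ∂(volume.restrict (Iio T ×ˢ (univ : Set (EuclideanSpace ℝ (Fin 3))))), u z.1 z.2 = u t₀ z.2 := by
  classical
  -- countable dense families of spatial test functions supported in the closed balls
  have hfam : ∀ n : ℕ, ∃ D : Set (EuclideanSpace ℝ (Fin 3) → ℝ), D.Countable ∧
      (∀ ψ ∈ D, IsTestFunctionOn (⊤ : Opens (EuclideanSpace ℝ (Fin 3))) ψ ∧ tsupport ψ ⊆ closedBall (0 : EuclideanSpace ℝ (Fin 3)) n) ∧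
      ∀ ψ : EuclideanSpace ℝ (Fin 3) → ℝ, IsTestFunctionOn (⊤ : Opens (EuclideanSpace ℝ (Fin 3))) ψ →
        tsupport ψ ⊆ closedBall (0 : EuclideanSpace ℝ (Fin 3)) n →
          ∃ s : ℕ → EuclideanSpace ℝ (Fin 3) → ℝ, (∀ k, s k ∈ D) ∧ TendstoUniformly s ψ atTop ∧
            TendstoUniformly (fun k => fderiv ℝ (s k)) (fderiv ℝ ψ) atTop := fun n =>
    exists_countable_testFunctions_dense (⊤ : Opens (EuclideanSpace ℝ (Fin 3))) (isCompact_closedBall 0 n)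
  choose D hDc hD hDd using hfam
  -- windows `(T - m - 2, T - 1/(m+1))` exhausting `(−∞, T)`
  set wa : ℕ → ℝ := fun m => T - m - 2 with hwa
  set wb : ℕ → ℝ := fun m => T - 1 / ((m : ℝ) + 1) with hwb
  have hwbT : ∀ m, wb m < T := fun m => by
    simp only [hwb]
    have : (0 : ℝ) < 1 / ((m : ℝ) + 1) := by positivity
    linarith
  -- the constants of the pairings on each window
  have hconst : ∀ (m n : ℕ) (χ : D n) (i : Fin 3), ∃ C : ℝ, ∀ᵐ t ∂(volume.restrict (Ioo (wa m) (wb m))),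
      ∫ x, (χ : EuclideanSpace ℝ (Fin 3) → ℝ) x * ⟪u t x, EuclideanSpace.single i (1 : ℝ)⟫ = C := fun m n χ i =>
    exists_pairing_ae_const hu hsteady (hwbT m) (hD n χ χ.2).1.contDiff.continuous (hD n χ χ.2).1.hasCompactSupport _
  choose C hC using hconst
  -- good times
  have hcount : ∀ n, Countable (D n) := fun n => (hDc n).to_subtype
  have hgood : ∀ᵐ t ∂(volume.restrict (Iio T)), LocallyIntegrable (u t) volume ∧
      ∀ (m n : ℕ) (χ : D n) (i : Fin 3), t ∈ Ioo (wa m) (wb m) →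
        ∫ x, (χ : EuclideanSpace ℝ (Fin 3) → ℝ) x * ⟪u t x, EuclideanSpace.single i (1 : ℝ)⟫ = C m n χ i := by
    refine hsl.and ?_
    refine ae_all_iff.2 fun m => ae_all_iff.2 fun n => ae_all_iff.2 fun χ => ae_all_iff.2 fun i => ?_
    have h1 := hC m n χ i
    have h2 : ∀ᵐ t ∂(volume : Measure ℝ), t ∈ Ioo (wa m) (wb m) →
        ∫ x, (χ : EuclideanSpace ℝ (Fin 3) → ℝ) x * ⟪u t x, EuclideanSpace.single i (1 : ℝ)⟫ = C m n χ i :=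
      ae_imp_of_ae_restrict h1
    exact ae_restrict_of_ae h2
  -- a good reference time
  have hpos : (volume : Measure ℝ) (Iio T) ≠ 0 := by
    rw [Real.volume_Iio]; exact ENNReal.top_ne_zero
  obtain ⟨t₀, ht₀T, ht₀l, ht₀C⟩ := Measure.exists_mem_of_measure_ne_zero_of_ae hpos hgood
  refine ⟨t₀, ht₀T, ht₀l, ?_⟩
  -- every good time has the slice of `t₀`
  have hslice : ∀ᵐ t ∂(volume.restrict (Iio T)), (fun x => u t x - u t₀ x) =ᵐ[volume] 0 := by
    rw [ae_restrict_iff' measurableSet_Iio] at hgood ⊢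
    filter_upwards [hgood] with t hgt htT
    obtain ⟨htl, htC⟩ := hgt htT
    -- a common window containing `t` and `t₀`
    obtain ⟨m, hm, hm₀⟩ : ∃ m : ℕ, t ∈ Ioo (wa m) (wb m) ∧ t₀ ∈ Ioo (wa m) (wb m) := by
      have hδ : 0 < T - max t t₀ := by
        have := max_lt (show t < T from htT) ht₀T; linarith
      obtain ⟨N₁, hN₁⟩ := exists_nat_gt (T - min t t₀)
      obtain ⟨N₂, hN₂⟩ := exists_nat_gt (1 / (T - max t t₀))
      refine ⟨max N₁ N₂, ⟨?_, ?_⟩, ⟨?_, ?_⟩⟩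
      · simp only [hwa]
        have h1 : (N₁ : ℝ) ≤ (max N₁ N₂ : ℕ) := by exact_mod_cast le_max_left N₁ N₂
        have h2 : min t t₀ ≤ t := min_le_left _ _
        linarith
      · simp only [hwb]
        have h1 : (N₂ : ℝ) ≤ (max N₁ N₂ : ℕ) := by exact_mod_cast le_max_right N₁ N₂
        have h3 : 1 / (T - max t t₀) < (max N₁ N₂ : ℕ) + 1 := by linarith
        have h4 : 1 / (((max N₁ N₂ : ℕ) : ℝ) + 1) < T - max t t₀ := by
          rw [div_lt_iff₀ (by positivity)]
          rw [div_lt_iff₀ hδ] at h3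
          linarith
        have h5 : t ≤ max t t₀ := le_max_left _ _
        linarith
      · simp only [hwa]
        have h1 : (N₁ : ℝ) ≤ (max N₁ N₂ : ℕ) := by exact_mod_cast le_max_left N₁ N₂
        have h2 : min t t₀ ≤ t₀ := min_le_right _ _
        linarith
      · simp only [hwb]
        have h1 : (N₂ : ℝ) ≤ (max N₁ N₂ : ℕ) := by exact_mod_cast le_max_right N₁ N₂
        have h3 : 1 / (T - max t t₀) < (max N₁ N₂ : ℕ) + 1 := by linarith
        have h4 : 1 / (((max N₁ N₂ : ℕ) : ℝ) + 1) < T - max t t₀ := by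
          rw [div_lt_iff₀ (by positivity)]
          rw [div_lt_iff₀ hδ] at h3
          linarith
        have h5 : t₀ ≤ max t t₀ := le_max_right _ _
        linarith
    have heq : ∀ n, ∀ χ ∈ D n, ∀ i : Fin 3,
        ∫ x, χ x * ⟪u t x, EuclideanSpace.single i (1 : ℝ)⟫ = ∫ x, χ x * ⟪u t₀ x, EuclideanSpace.single i (1 : ℝ)⟫ := by
      intro n χ hχ i
      rw [htC m n ⟨χ, hχ⟩ i hm, ht₀C m n ⟨χ, hχ⟩ i hm₀]
    have h := ae_eq_of_pairings_eq htl ht₀l hD hDd heq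
    filter_upwards [h] with x hx
    simp [hx]
  -- slices to slab
  have hmeas : AEStronglyMeasurable (uncurry fun t x => u t x - u t₀ x)
      (volume.restrict (Iio T ×ˢ (univ : Set (EuclideanSpace ℝ (Fin 3))))) := by
    have h1 : AEStronglyMeasurable (uncurry u) (volume.restrict (Iio T ×ˢ (univ : Set (EuclideanSpace ℝ (Fin 3))))) :=
      hu.aestronglyMeasurable
    have h2 : AEStronglyMeasurable (fun z : ℝ × EuclideanSpace ℝ (Fin 3) => u t₀ z.2)
        (volume.restrict (Iio T ×ˢ (univ : Set (EuclideanSpace ℝ (Fin 3))))) := by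
      have h3 : AEStronglyMeasurable (fun z : ℝ × EuclideanSpace ℝ (Fin 3) => u t₀ z.2)
          (((volume : Measure ℝ).restrict (Iio T)).prod (volume : Measure (EuclideanSpace ℝ (Fin 3)))) :=
        ht₀l.aestronglyMeasurable.comp_snd
      rwa [Measure.restrict_prod_eq_prod_univ, ← Measure.volume_eq_prod] at h3
    exact h1.sub h2
  have h0 := FrameSteady.ae_zero_of_ae_slice hmeas hslice
  filter_upwards [h0] with z hz
  exact sub_eq_zero.1 hz

end DistSteady

end Summit.NavierStokesRegularity.NavierStokesRegularity.Theorems.PowerGaugeEulerLiouville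

end
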